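import Mathlib
import HarnessLib
import Literature.Analysis.FluidPDE.ClassicalSolution
import Literature.Analysis.FluidPDE.LerayHopf
import Literature.Analysis.FluidPDE.SelfSimilar
import Literature.Analysis.FluidPDE.SelfSimilarLiouville
import Literature.Analysis.FluidPDE.LocalTypeI
import Literature.Analysis.FluidPDE.VectorCalculus
import Literature.Analysis.FluidPDE.TypeIAncientMild
import Literature.Analysis.FluidPDE.ChaeWolfRemovingDSS
import Literature.Analysis.FluidPDE.ChaeWolfRemovingDSSProofs
import Literature.Analysis.FluidPDE.ChaeWolfRemovingDSSLimit
import Literature.Analysis.UnboundedOperators.HeatKernel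
import Summits.NavierStokesRegularity.NavierStokesRegularity.Theorems.LocalVelCompTubeDoorLocalPointZoomVelSlices
import Summits.NavierStokesRegularity.NavierStokesRegularity.Theorems.PlaneStrainDoorZoomSpaceTimeDecay
import Summits.NavierStokesRegularity.NavierStokesRegularity.Theorems.LocalSineTubeDoorProfileAlignedWindowRigidityAncient
import Summits.NavierStokesRegularity.NavierStokesRegularity.Theorems.PoloidalWindowDoorPoloidalWindowRigidityStrata
import Summits.NavierStokesRegularity.NavierStokesRegularity.Theorems.PoloidalWindowDoorPoloidalWindowRigidityFlat
import Summits.NavierStokesRegularity.NavierStokesRegularity.Theorems.PoloidalWindowDoorPoloidalWindowRigidityWindow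
import Summits.NavierStokesRegularity.NavierStokesRegularity.Theorems.TypeIDSSLiouvilleConjecture
import Summits.NavierStokesRegularity.NavierStokesRegularity.Theorems.AdaptedFrequencyTangentFlowTransferAncientPressure
import Summits.NavierStokesRegularity.NavierStokesRegularity.Theorems.PeepholeEchoDoorDefs
import Summits.NavierStokesRegularity.NavierStokesRegularity.Theorems.ZoomReturnDoorDefs

/-!
# ZoomReturnDoorRemovableFactors — S25 «ZoomReturnDoor» (small echoes near ratio one; removable DSS factors), part 3/4

§2 the λ-AXIS PACKAGE around the two claimed compactness theorems K-open `RemovableSetOpen` and K-band `BandStability`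
(neither is proved here; both enter as hypotheses): `removable_nearOne` (Chae–Wolf), `removable_antitone`, `not_removable_pow`,
`exists_minimalBadFactor` (the MINIMAL BAD FACTOR, from K-open), `removable_all_of_isOpen_bad` (clopen principle, from K-open),
the converse of K-band `removable_of_bandResidue` («ε-stable ⇒ removable»), and `bandResidue_nearOne` (K-band on a near-one band).
DSS-factor-axis sibling of the tree's rotation-speed-axis package `TypeICertificateLadderTargetRssCompactness*`.

Door family of LADDER-NS N0 (local Type-I window doors S20–S25); THEOREMS-ONLY landing of the nsreg-p1 design
`run/shared/lean/pub/ns-regularity-ideate/ns-regularity-ideate-p1/r24/Sketch25.lean` (ROUND-24.md).  Door T5⁺ «no SMALL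
near-one echo»: a space–time local Type-I point whose two-time defect at a ratio in a near-one band is EVENTUALLY `ε`-small on
a window (`ε` fixed before the ratio) is regular; corollary door T6 «restless profile».  Everything conditional is conditional on
the two CLAIMED compactness theorems K-band `BandStability` / K-open `RemovableSetOpen` (Chae–Wolf 2017 §3 engine, tree
`Literature.Analysis.FluidPDE.ChaeWolf.exists_limit`, run with a convergent factor sequence), which enter as hypotheses.
No route, no items (DIRECTOR-NS standing #32 (2)).  WHAT THIS IS NOT: not a regularity claim; not an attack on
`TypeIDSSLiouville`; the band door is EXACTLY as strong as the graded DSS wall on its band (`removable_of_bandResidue`).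
-/

noncomputable section

set_option linter.dupNamespace false

namespace Summit.NavierStokesRegularity.NavierStokesRegularity.Theorems.ZoomReturnDoorRemovableFactors

open MeasureTheory Set Function Filter Topology TopologicalSpace Metric
open scoped RealInnerProductSpace NNReal ENNReal Topology Pointwise
open Literature.Analysis Literature.Analysis.FluidPDE
open Summit.NavierStokesRegularity.NavierStokesRegularity.Theorems.LocalSineTubeDoorProfileAlignedWindowRigidityAncient
open Summit.NavierStokesRegularity.NavierStokesRegularity.Theorems.PoloidalWindowDoorPoloidalWindowRigidityStrata
open Summit.NavierStokesRegularity.NavierStokesRegularity.Theorems.PoloidalWindowDoorPoloidalWindowRigidityFlat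
open Summit.NavierStokesRegularity.NavierStokesRegularity.Theorems.PoloidalWindowDoorPoloidalWindowRigidityWindow
open Summit.NavierStokesRegularity.NavierStokesRegularity.Theorems.PeepholeEchoDoorDefs
open Summit.NavierStokesRegularity.NavierStokesRegularity.Theorems.ZoomReturnDoorDefs

/-- Chae–Wolf 2017 Thm 1.3 in this vocabulary (tree theorem `chaeWolf2017_removing_dss_holds`): a right
neighbourhood of `1` is removable. -/
theorem removable_nearOne {D : ℝ} (hD : 0 < D) :
    ∃ c₁ : ℝ, 1 < c₁ ∧ ∀ c : ℝ, 1 < c → c < c₁ → RemovableFactor D c := by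
  obtain ⟨c₁, hc₁, h⟩ := chaeWolf2017_removing_dss_holds D hD
  exact ⟨c₁, hc₁, fun c h1 h2 u p hcl hdss hI => h c h1 h2 u p hcl hdss hI⟩

/-- Type-I decay is monotone in the constant. -/
theorem hasTypeIDecay_mono {D D' : ℝ} {u : ℝ → EuclideanSpace ℝ (Fin 3) → EuclideanSpace ℝ (Fin 3)}
    (h : Literature.Analysis.FluidPDE.HasTypeIDecay D u) (hDD' : D ≤ D') :
    Literature.Analysis.FluidPDE.HasTypeIDecay D' u := by
  intro t ht x
  have hden : 0 < ‖x‖ + Real.sqrt (-t) := by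
    have : 0 < Real.sqrt (-t) := Real.sqrt_pos.2 (by linarith)
    positivity
  exact (h t ht x).trans (div_le_div_of_nonneg_right hDD' hden.le)

/-- Removability is ANTITONE in the decay constant (a larger class is harder to remove). -/
theorem removable_antitone {D D' c : ℝ} (hDD' : D ≤ D') (h : RemovableFactor D' c) : RemovableFactor D c :=
  fun u p hcl hdss hI => h u p hcl hdss (hasTypeIDecay_mono hI hDD')

/-- POWERS OF BAD FACTORS ARE BAD (a nontrivial `c`-DSS profile is `cᵏ`-DSS). -/
theorem not_removable_pow {D c : ℝ} (h : ¬ RemovableFactor D c) (k : ℕ) : ¬ RemovableFactor D (c ^ k) := by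
  intro hk
  apply h
  intro u p hcl hdss hI
  exact hk u p hcl (ChaeWolf.isDiscretelySelfSimilar_pow hdss k) hI

/-- **THE MINIMAL BAD FACTOR** (PROVED from K-open + Chae–Wolf): if the graded DSS wall fails at decay `D`, it fails at
a LEAST factor `c_min > 1`, which is attained, and every factor in `(1, c_min)` is removable. -/
theorem exists_minimalBadFactor (hopen : RemovableSetOpen) {D : ℝ} (hD : 0 < D)
    (hbad : ∃ c : ℝ, 1 < c ∧ ¬ RemovableFactor D c) :
    ∃ cm : ℝ, 1 < cm ∧ ¬ RemovableFactor D cm ∧ ∀ c : ℝ, 1 < c → c < cm → RemovableFactor D c := by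
  obtain ⟨c₁, hc₁, hcw⟩ := removable_nearOne hD
  obtain ⟨c₀, hc₀, hbad₀⟩ := hbad
  set c' : ℝ := (1 + c₁) / 2 with hc'
  have hc'1 : 1 < c' := by rw [hc']; linarith
  have hc'2 : c' < c₁ := by rw [hc']; linarith
  set S : Set ℝ := Set.Ici c' ∩ (removableSet D)ᶜ with hS
  have hSc : IsClosed S := isClosed_Ici.inter (hopen D hD).isClosed_compl
  have hmemS : ∀ {c : ℝ}, c ∈ S ↔ c' ≤ c ∧ ¬ RemovableFactor D c := by
    intro c
    simp only [hS, Set.mem_inter_iff, Set.mem_Ici, Set.mem_compl_iff, removableSet, Set.mem_setOf_eq, not_and]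
    constructor
    · rintro ⟨h1, h2⟩
      exact ⟨h1, h2 (lt_of_lt_of_le hc'1 h1)⟩
    · rintro ⟨h1, h2⟩
      exact ⟨h1, fun _ => h2⟩
  have hc₀S : c₀ ∈ S := by
    refine hmemS.2 ⟨?_, hbad₀⟩
    by_contra hlt
    push Not at hlt
    exact hbad₀ (hcw c₀ hc₀ (hlt.trans hc'2))
  have hne : S.Nonempty := ⟨c₀, hc₀S⟩
  have hbdd : BddBelow S := ⟨c', fun c hc => (hmemS.1 hc).1⟩
  have hmin : sInf S ∈ S := hSc.csInf_mem hne hbdd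
  refine ⟨sInf S, lt_of_lt_of_le hc'1 (hmemS.1 hmin).1, (hmemS.1 hmin).2, fun c h1 h2 => ?_⟩
  by_contra hc
  rcases lt_or_ge c c₁ with h3 | h3
  · exact hc (hcw c h1 h3)
  · have hcS : c ∈ S := hmemS.2 ⟨hc'2.le.trans h3, hc⟩
    exact absurd (csInf_le hbdd hcS) (not_le.2 h2)

/-- **Clopen principle on the factor axis** (PROVED from K-open; the analogue of the tree's
`rssCompact_liouville_of_isOpen_bad` on the rotation-speed axis): at a decay level `D > 0`, if the BAD set of factors
is open then it is empty — `(1,∞)` is connected, the removable set is open (K-open) and nonempty (Chae–Wolf near one).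
So, given K-open, Tsai's graded conjecture at level `D` is EQUIVALENT to «every bad factor has bad factors arbitrarily
close to it on both sides», i.e. a fixed-level perturbation theory of counterexamples would settle the level. -/
theorem removable_all_of_isOpen_bad (hopen : RemovableSetOpen) {D : ℝ} (hD : 0 < D)
    (hbad : IsOpen {c : ℝ | 1 < c ∧ ¬ RemovableFactor D c}) : ∀ c : ℝ, 1 < c → RemovableFactor D c := by
  by_contra hcon
  push Not at hcon
  obtain ⟨c, hc1, hc⟩ := hcon
  obtain ⟨c₁, hc₁, hnear⟩ := removable_nearOne hD
  have hpre := isPreconnected_Ioi (a := (1 : ℝ))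
  rw [IsPreconnected] at hpre
  have hcover : Set.Ioi (1 : ℝ) ⊆ removableSet D ∪ {c : ℝ | 1 < c ∧ ¬ RemovableFactor D c} := by
    intro x hx
    by_cases h : RemovableFactor D x
    · exact Or.inl ⟨hx, h⟩
    · exact Or.inr ⟨hx, h⟩
  have hgood : (Set.Ioi (1 : ℝ) ∩ removableSet D).Nonempty := by
    refine ⟨(1 + c₁) / 2, ?_, ?_⟩
    · show (1 : ℝ) < (1 + c₁) / 2
      linarith
    · exact ⟨by linarith, hnear _ (by linarith) (by linarith)⟩
  have hbadne : (Set.Ioi (1 : ℝ) ∩ {c : ℝ | 1 < c ∧ ¬ RemovableFactor D c}).Nonempty := ⟨c, hc1, hc1, hc⟩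
  obtain ⟨x, -, hxgood, hxbad⟩ := hpre _ _ (hopen D hD) hbad hcover hgood hbadne
  exact hxbad.2 hxgood.2

/-- The identically-zero profile is not backward singular at the apex. -/
theorem not_isBackwardSingularPoint_of_eq_zero {v : ℝ → EuclideanSpace ℝ (Fin 3) → EuclideanSpace ℝ (Fin 3)}
    (h : ∀ s < 0, ∀ z, v s z = 0) : ¬ Literature.Analysis.FluidPDE.IsBackwardSingularPoint v 0 := by
  intro hsing
  have h1 := hsing 1 one_pos
  have hS : MeasurableSet (parabolicCylinder (1 : ℝ) (0 : ℝ × EuclideanSpace ℝ (Fin 3))) := by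
    unfold parabolicCylinder
    exact measurableSet_Ioo.prod Metric.isOpen_ball.measurableSet
  have hae : (Function.uncurry v) =ᵐ[volume.restrict (parabolicCylinder (1 : ℝ) (0 : ℝ × EuclideanSpace ℝ (Fin 3)))]
      (0 : ℝ × EuclideanSpace ℝ (Fin 3) → EuclideanSpace ℝ (Fin 3)) := by
    refine (ae_restrict_iff' hS).2 (Filter.Eventually.of_forall ?_)
    rintro ⟨s, z⟩ hq
    have hq' := (Set.mem_prod.1 hq).1
    simp only [Set.mem_Ioo] at hq'
    have hs : s < 0 := by simpa using hq'.2
    simp [Function.uncurry, h s hs z]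
  rw [eLpNorm_congr_ae hae, eLpNorm_zero] at h1
  exact ENNReal.zero_ne_top h1

/-- THE CONVERSE IS ELEMENTARY (PROVED): an `ε`-stable band consists of removable factors, because an exactly
`(1/√κ)`-DSS field has ZERO defect at ratio `κ`.  With K-band: «ε-stable band ⟺ removable band». -/
theorem removable_of_bandResidue {ν D a b : ℝ} (ha : 0 < a) (h : BandResidue ν D a b) :
    ∀ κ ∈ Set.Icc a b, RemovableFactor D (Real.sqrt κ)⁻¹ := by
  intro κ hκ u p hcl hdss hI
  obtain ⟨ε, _, hres⟩ := h (Metric.ball 0 1) Metric.isOpen_ball ⟨0, Metric.mem_ball_self one_pos⟩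
    Metric.isBounded_ball
  refine hres κ hκ u p hcl hI ?_
  have hκ0 : 0 < κ := ha.trans_le hκ.1
  have hsq : Real.sqrt κ ≠ 0 := (Real.sqrt_pos.2 hκ0).ne'
  set c : ℝ := (Real.sqrt κ)⁻¹ with hc
  have hc2 : c ^ 2 * κ = 1 := by rw [hc, inv_pow, Real.sq_sqrt hκ0.le, inv_mul_cancel₀ hκ0.ne']
  intro s _
  have hzero : ∀ y, profileDefect ν u κ (Real.sqrt κ) s y = 0 := by
    intro y
    unfold profileDefect
    set r : ℝ := Real.sqrt (-s) / Real.sqrt ν with hr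
    have key : u (κ * s) ((Real.sqrt κ * r) • y) = c • u s (r • y) := by
      have h1 := ChaeWolf.dss_apply_eq hdss (κ * s) ((Real.sqrt κ * r) • y)
      have e1 : c ^ 2 * (κ * s) = s := by rw [← mul_assoc, hc2, one_mul]
      have e2 : c * (Real.sqrt κ * r) = r := by rw [← mul_assoc, hc, inv_mul_cancel₀ hsq, one_mul]
      rw [smul_smul, e1, e2] at h1
      exact h1.symm
    have e3 : Real.sqrt κ * r * ν * c = r * ν := by
      calc Real.sqrt κ * r * ν * c = (Real.sqrt κ * c) * (r * ν) := by ring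
        _ = r * ν := by rw [hc, mul_inv_cancel₀ hsq, one_mul]
    rw [key, smul_smul, e3, sub_self, norm_zero]
  simp only [hzero, ENNReal.ofReal_zero, lintegral_zero, zero_le]

/-- Near one every band is removable (Chae–Wolf), so K-band makes every near-one band `ε`-stable (PROVED from K-band). -/
theorem bandResidue_nearOne (hB : BandStability) {ν D : ℝ} (hν : 0 < ν) (hD : 0 < D) :
    ∃ κ₁ : ℝ, 0 < κ₁ ∧ κ₁ < 1 ∧ ∀ a b : ℝ, κ₁ < a → b < 1 → BandResidue ν D a b := by
  obtain ⟨c₁, hc₁, hcw⟩ := removable_nearOne hD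
  have hc₁0 : 0 < c₁ := by linarith
  have hi0 : 0 < c₁⁻¹ := by positivity
  have hi1 : c₁⁻¹ < 1 := inv_lt_one_of_one_lt₀ hc₁
  refine ⟨(c₁⁻¹) ^ 2, by positivity, by nlinarith, fun a b ha hb => ?_⟩
  have ha0 : 0 < a := lt_trans (by positivity) ha
  refine hB ν D a b hν hD ha0 hb fun κ hκ => ?_
  have hκ0 : 0 < κ := ha0.trans_le hκ.1
  have hsκ : 0 < Real.sqrt κ := Real.sqrt_pos.2 hκ0
  have h1 : 1 < (Real.sqrt κ)⁻¹ := by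
    rw [one_lt_inv₀ hsκ, Real.sqrt_lt' one_pos, one_pow]
    linarith [hκ.2]
  have h2 : (Real.sqrt κ)⁻¹ < c₁ := by
    rw [inv_lt_comm₀ hsκ hc₁0, Real.lt_sqrt hi0.le]
    exact lt_of_lt_of_le ha hκ.1
  exact hcw _ h1 h2

end Summit.NavierStokesRegularity.NavierStokesRegularity.Theorems.ZoomReturnDoorRemovableFactors
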